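import Summits.HubbardSuperconductivity.HubbardSuperconductivity.Theses.LevyLogBootstrap
import Summits.HubbardSuperconductivity.HubbardSuperconductivity.Theorems.PolyaSchurPairBosonSectorPerronXXZ
import Literature.MathematicalPhysics.QuantumLattice.InfiniteVolumeSpinEntriesProofs
import Literature.MathematicalPhysics.QuantumLattice.ProductOperators
import HarnessLib

/-!
# Crux `Block2InfDivXXZ` (stmt-HubbardSuperconductivity-15048, route `LevyLogBootstrap`), line `birth`:
# stub `stub_transverseKernelPos` — Perron–Frobenius positivity of the transverse kernel

Registered stub (skeleton `Cruxes/Block2InfDivXXZ/Lines/birth.lean`): for every even `M ≥ 4`, every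
`Δ ∈ [-1, 0]` and every normalised `S^z_tot = 0` sector ground state `ψ` of
`H_M(Δ) = xxzHamiltonian 1 (torusGraph 2 M) (-1) Δ`, the raw transverse kernel is entrywise strictly
positive: `0 < Re⟨ψ, S⁺_{x'} S⁻_{y'} ψ⟩` for all sites `x', y'`.

Proof (Marshall 1955 / Perron–Frobenius; Tasaki (2020) §2.4): `H_M(Δ)` is stoquastic in the Ising
basis for every real `Δ` (off-diagonal entries `-½ ≤ 0`, one hop per edge, weight preserving —
`leadPF_entries` at zero field) and the torus graph is connected, so the weight sector `W = M²/2`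
(= `S^z_tot = 0`, `M` even) has a nonzero real nonnegative ground vector `ψ₀`, unique up to scalars
(LANDED: `xxz_sector_perronFrobenius`); the eigen-equation and hop-connectivity of the sector make
`ψ₀` STRICTLY positive on the sector (`sector_groundVec_pos`: a zero entry forces zero entries at
all hop-neighbours). Then `ψ = c • ψ₀`, `c ≠ 0` (`‖ψ‖ = 1`); `S⁺_{x'} S⁻_{y'}` is entrywise
nonnegative real, so `Re⟨ψ, S⁺_{x'}S⁻_{y'} ψ⟩ = ‖c‖² Re⟨ψ₀, S⁺_{x'}S⁻_{y'} ψ₀⟩` is bounded below by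
one term of the double sum, whose witness pair lies in the sector (`1 ≤ M²/2 ≤ M² - 2`) with entry
`1`. The hypothesis `Δ ∈ [-1,0]` is not used. No definition is introduced; sorry-free. -/

noncomputable section

set_option linter.dupNamespace false

namespace Summit.HubbardSuperconductivity.HubbardSuperconductivity.Theorems.LevyLogBootstrap

open scoped BigOperators Matrix ComplexOrder
open Matrix Finset Complex
open Literature.MathematicalPhysics.QuantumLattice Literature.Probability.LatticeModels
open Summit.AtomisticToContinuum.BoseEinsteinCondensation.Theorems.BECStronglyRayleighSectorPerron
open Summit.AtomisticToContinuum.BoseEinsteinCondensation.Theorems.InsertionFieldDelocalisation.Negative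
open Summit.HubbardSuperconductivity.HubbardSuperconductivity.Theorems.PolyaSchurPairBoson

/-! ### Strict positivity of a nonnegative sector ground vector -/

section Abstract

variable {Λ : Type*} [Fintype Λ] [DecidableEq Λ] (n : ℕ) (G : SimpleGraph Λ) [DecidableRel G.Adj]

/-- **A nonnegative sector eigenvector of a stoquastic Hamiltonian is strictly positive on its
weight sector** (connected hop graph): if `H` has real entries, nonpositive off the diagonal and
nonzero along the hops of `heisenbergHamiltonian n G 1`, `G` connected, and `ψ ≠ 0` is entrywise
nonnegative real, vanishes off the weight-`W` configurations and satisfies `H ψ = E ψ`, then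
`Re ψ(σ) > 0` for every `σ` of weight `W` — a vanishing entry forces, through row `σ` of the
eigen-equation (a sum of nonpositive reals), vanishing entries at all hop-neighbours.
Tasaki (2020) §2.4; Lieb–Wu, Physica A 321 (2003) §2. [folklore] -/
theorem sector_groundVec_pos (hG : G.Connected) (H : Op Λ (n + 1))
    (hhop : ∀ σ τ : TensorIndex Λ (n + 1), σ ≠ τ → heisenbergHamiltonian n G 1 σ τ ≠ 0 → H σ τ ≠ 0)
    (hreal : ∀ σ τ : TensorIndex Λ (n + 1), star (H σ τ) = H σ τ)
    (hoff : ∀ σ τ : TensorIndex Λ (n + 1), σ ≠ τ → (H σ τ).re ≤ 0) (W : ℕ)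
    {ψ : TensorIndex Λ (n + 1) → ℂ} (hψK : ∀ σ, (∑ z, (σ z : ℕ)) ≠ W → ψ σ = 0)
    (hnn : ∀ σ, 0 ≤ (ψ σ).re ∧ (ψ σ).im = 0) {E : ℂ} (hHψ : H *ᵥ ψ = E • ψ) (hψ0 : ψ ≠ 0) :
    ∀ σ, (∑ z, (σ z : ℕ)) = W → 0 < (ψ σ).re := by
  have him : ∀ σ τ, (H σ τ).im = 0 := fun σ τ => by
    have h := congrArg Complex.im (hreal σ τ)
    rw [Complex.star_def, Complex.conj_im] at h
    linarith
  -- one step: a zero entry kills the entries at all `τ` with `H σ τ ≠ 0`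
  have hstep : ∀ σ τ, (ψ σ).re = 0 → σ ≠ τ → H σ τ ≠ 0 → (ψ τ).re = 0 := by
    intro σ τ h0 hne hH
    have hψσ : ψ σ = 0 := Complex.ext (by rw [h0, Complex.zero_re]) (by rw [(hnn σ).2, Complex.zero_im])
    have hrow := congrFun hHψ σ
    rw [Pi.smul_apply, hψσ, smul_zero, mulVec, dotProduct] at hrow
    have hterm : ∀ ρ, (H σ ρ * ψ ρ).re ≤ 0 := by
      intro ρ
      by_cases hσρ : σ = ρ
      · subst hσρ
        rw [hψσ, mul_zero, Complex.zero_re]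
      · rw [Complex.mul_re, him, (hnn ρ).2, mul_zero, sub_zero]
        exact mul_nonpos_of_nonpos_of_nonneg (hoff σ ρ hσρ) (hnn ρ).1
    have hsum : ∑ ρ, (H σ ρ * ψ ρ).re = 0 := by rw [← Complex.re_sum, hrow, Complex.zero_re]
    have hz := (Finset.sum_eq_zero_iff_of_nonpos fun ρ _ => hterm ρ).1 hsum τ (Finset.mem_univ τ)
    rw [Complex.mul_re, him, (hnn τ).2, mul_zero, sub_zero] at hz
    rcases mul_eq_zero.1 hz with h | h
    · exact absurd (Complex.ext (by rw [h, Complex.zero_re]) (by rw [him, Complex.zero_im])) hH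
    · exact h
  -- propagation along hops inside the sector
  set ι := {σ : TensorIndex Λ (n + 1) // (∑ z, (σ z : ℕ)) = W}
  set B : Matrix ι ι ℂ := Matrix.of fun s t => if s = t then (1 : ℂ) else H s.1 t.1 with hBdef
  have hBaux : ∀ s t : ι, heisenbergHamiltonian n G 1 s.1 t.1 ≠ 0 → B s t ≠ 0 := by
    intro s t hst
    by_cases hst' : s = t
    · rw [hBdef, Matrix.of_apply, if_pos hst']
      exact one_ne_zero
    · rw [hBdef, Matrix.of_apply, if_neg hst']
      exact hhop _ _ (fun h => hst' (Subtype.ext h)) hst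
  have hprop : ∀ s t : ι, (ψ s.1).re = 0 → (ψ t.1).re = 0 := by
    intro s t hs
    have h := LiebMattis.reflTransGen_subtype n G 1 hG one_pos W hBaux s t
    induction h with
    | refl => exact hs
    | @tail b c _ hbc ih =>
      by_cases hbc' : b = c
      · rw [← hbc']
        exact ih
      · rw [hBdef, Matrix.of_apply, if_neg hbc'] at hbc
        exact hstep _ _ ih (fun h => hbc' (Subtype.ext h)) hbc
  intro σ hσ
  rcases (hnn σ).1.lt_or_eq with h | h
  · exact h
  · exfalso
    apply hψ0
    funext τ
    by_cases hτ : (∑ z, (τ z : ℕ)) = W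
    · exact Complex.ext (by rw [hprop ⟨σ, hσ⟩ ⟨τ, hτ⟩ h.symm, Pi.zero_apply, Complex.zero_re])
        (by rw [(hnn τ).2, Pi.zero_apply, Complex.zero_im])
    · rw [hψK τ hτ, Pi.zero_apply]

end Abstract

/-! ### Entrywise "nonnegative real" matrices and the quadratic-form lower bound -/

section Nonneg

variable {ι : Type*}

/-- Products of "nonnegative real" complex numbers are "nonnegative real". [folklore] -/
theorem nnreal_mul {a b : ℂ} (ha : 0 ≤ a.re ∧ a.im = 0) (hb : 0 ≤ b.re ∧ b.im = 0) :
    0 ≤ (a * b).re ∧ (a * b).im = 0 := by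
  refine ⟨?_, ?_⟩
  · rw [Complex.mul_re, ha.2, hb.2, mul_zero, sub_zero]
    exact mul_nonneg ha.1 hb.1
  · rw [Complex.mul_im, ha.2, hb.2, mul_zero, zero_mul, add_zero]

/-- Finite sums of "nonnegative real" complex numbers are "nonnegative real". [folklore] -/
theorem nnreal_sum {s : Finset ι} {f : ι → ℂ} (hf : ∀ i ∈ s, 0 ≤ (f i).re ∧ (f i).im = 0) :
    0 ≤ (∑ i ∈ s, f i).re ∧ (∑ i ∈ s, f i).im = 0 := by
  refine ⟨?_, ?_⟩
  · rw [Complex.re_sum]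
    exact Finset.sum_nonneg fun i hi => (hf i hi).1
  · rw [Complex.im_sum]
    exact Finset.sum_eq_zero fun i hi => (hf i hi).2

/-- Entries of a product of entrywise "nonnegative real" matrices are "nonnegative real".
[folklore] -/
theorem nnreal_matrix_mul [Fintype ι] {A B : Matrix ι ι ℂ}
    (hA : ∀ i j, 0 ≤ (A i j).re ∧ (A i j).im = 0) (hB : ∀ i j, 0 ≤ (B i j).re ∧ (B i j).im = 0)
    (i j : ι) : 0 ≤ ((A * B) i j).re ∧ ((A * B) i j).im = 0 := by
  rw [Matrix.mul_apply]
  exact nnreal_sum fun k _ => nnreal_mul (hA i k) (hB k j)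

/-- **One-term lower bound for a nonnegative quadratic form**: for entrywise "nonnegative real"
`A` and `v`, `Re v_{i₀} · Re A_{i₀ j₀} · Re v_{j₀} ≤ Re⟨v, A v⟩`. [folklore] -/
theorem re_quadForm_ge_entry [Fintype ι] (A : Matrix ι ι ℂ) (v : ι → ℂ)
    (hA : ∀ i j, 0 ≤ (A i j).re ∧ (A i j).im = 0) (hv : ∀ i, 0 ≤ (v i).re ∧ (v i).im = 0)
    (i₀ j₀ : ι) :
    (v i₀).re * (A i₀ j₀).re * (v j₀).re ≤ (star v ⬝ᵥ A *ᵥ v).re := by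
  classical
  have hstar : ∀ i, star (v i) = v i := fun i => by
    apply Complex.ext
    · simp
    · simp [(hv i).2]
  have hterm : ∀ i j, (star (v i) * (A i j * v j)).re = (v i).re * (A i j).re * (v j).re ∧
      0 ≤ (star (v i) * (A i j * v j)).re := by
    intro i j
    have hre : (star (v i) * (A i j * v j)).re = (v i).re * (A i j).re * (v j).re := by
      rw [hstar, Complex.mul_re, (hv i).2, zero_mul, sub_zero, Complex.mul_re, (hA i j).2,
        (hv j).2, mul_zero, sub_zero, mul_assoc]
    refine ⟨hre, ?_⟩
    rw [hre, mul_assoc]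
    exact mul_nonneg (hv i).1 (mul_nonneg (hA i j).1 (hv j).1)
  have hexp : (star v ⬝ᵥ A *ᵥ v).re = ∑ i, ∑ j, (star (v i) * (A i j * v j)).re := by
    rw [dotProduct, Complex.re_sum]
    refine Finset.sum_congr rfl fun i _ => ?_
    rw [Pi.star_apply, mulVec, dotProduct, Finset.mul_sum, Complex.re_sum]
  rw [hexp, ← (hterm i₀ j₀).1]
  refine le_trans ?_ (Finset.single_le_sum (f := fun i => ∑ j, (star (v i) * (A i j * v j)).re)
    (fun i _ => Finset.sum_nonneg fun j _ => (hterm i j).2) (Finset.mem_univ i₀))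
  exact Finset.single_le_sum (f := fun j => (star (v i₀) * (A i₀ j * v j)).re)
    (fun j _ => (hterm i₀ j).2) (Finset.mem_univ j₀)

end Nonneg

/-! ### Entries of `S⁺`, `S⁻`, `S⁺_x S⁻_y` (spin ½) and indicator configurations -/

section Entries

variable {Λ : Type*} [Fintype Λ] [DecidableEq Λ]

/-- Entries of `S⁺` are nonnegative reals. Tasaki (2020) §2.1, eq. (2.1.6). [folklore] -/
theorem spinRaise_nnreal (n : ℕ) (k l : Fin (n + 1)) :
    0 ≤ (spinRaise n k l).re ∧ (spinRaise n k l).im = 0 := by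
  rw [spinRaise_apply]
  split_ifs
  · exact ⟨by rw [Complex.ofReal_re]; exact Real.sqrt_nonneg _, Complex.ofReal_im _⟩
  · simp

/-- Entries of `S⁻ = (S⁺)ᴴ` are nonnegative reals. Tasaki (2020) §2.1. [folklore] -/
theorem spinLower_nnreal (n : ℕ) (k l : Fin (n + 1)) :
    0 ≤ (spinLower n k l).re ∧ (spinLower n k l).im = 0 := by
  rw [spinLower, conjTranspose_apply, Complex.star_def, Complex.conj_re, Complex.conj_im,
    neg_eq_zero]
  exact spinRaise_nnreal n l k

/-- Entries of `onSite x a` are nonnegative reals when those of `a` are. [folklore] -/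
theorem onSite_nnreal {q : ℕ} (x : Λ) {a : Matrix (Fin q) (Fin q) ℂ}
    (ha : ∀ k l, 0 ≤ (a k l).re ∧ (a k l).im = 0) (σ τ : TensorIndex Λ q) :
    0 ≤ (onSite x a σ τ).re ∧ (onSite x a σ τ).im = 0 := by
  rw [onSite_apply]
  split_ifs
  · exact ha _ _
  · simp

/-- Entries of the transverse pair operator `S⁺_x S⁻_y` (spin ½) are nonnegative reals.
[folklore] -/
theorem raiseLower_nnreal (x y : Λ) (σ τ : TensorIndex Λ 2) :
    0 ≤ ((onSite x (spinRaise 1) * onSite y (spinLower 1) : Op Λ 2) σ τ).re ∧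
      ((onSite x (spinRaise 1) * onSite y (spinLower 1) : Op Λ 2) σ τ).im = 0 :=
  nnreal_matrix_mul (fun σ τ => onSite_nnreal x (spinRaise_nnreal 1) σ τ)
    (fun σ τ => onSite_nnreal y (spinLower_nnreal 1) σ τ) σ τ

/-- `⟨0| S⁺ |1⟩ = 1` (spin ½). Tasaki (2020) §2.1, eq. (2.1.6). [folklore] -/
theorem spinRaise_one_zero_one : spinRaise 1 0 1 = 1 := by
  rw [spinRaise_apply]
  simp

/-- `⟨1| S⁻ |0⟩ = 1` (spin ½). Tasaki (2020) §2.1, eq. (2.1.6). [folklore] -/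
theorem spinLower_one_one_zero : spinLower 1 1 0 = 1 := by
  rw [spinLower, conjTranspose_apply, spinRaise_one_zero_one, star_one]

/-- `⟨0| S⁺ |0⟩ = 0` (spin ½). [folklore] -/
theorem spinRaise_one_zero_zero : spinRaise 1 0 0 = 0 := by
  rw [spinRaise_apply]
  simp

/-- Witness entry, `x ≠ y`: `σ x = 0` (up), `σ y = 1` (down), `τ` = `σ` with the two values
exchanged; then `⟨σ| S⁺_x S⁻_y |τ⟩ = 1`. [folklore] -/
theorem raiseLower_witness_ne {x y : Λ} (hxy : x ≠ y) (σ : TensorIndex Λ 2) (hσx : σ x = 0)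
    (hσy : σ y = 1) :
    (onSite x (spinRaise 1) * onSite y (spinLower 1) : Op Λ 2) σ
      (Function.update (Function.update σ x 1) y 0) = 1 := by
  rw [onSite_mul_onSite_apply hxy, if_pos]
  · rw [Function.update_of_ne hxy, Function.update_self, Function.update_self, hσx, hσy,
      spinRaise_one_zero_one, spinLower_one_one_zero, mul_one]
  · intro z hzx hzy
    rw [Function.update_of_ne hzy, Function.update_of_ne hzx]

/-- Witness entry, `x = y`: `σ x = 0` (up); then `⟨σ| S⁺_x S⁻_x |σ⟩ = 1`. [folklore] -/
theorem raiseLower_witness_eq (x : Λ) (σ : TensorIndex Λ 2) (hσx : σ x = 0) :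
    (onSite x (spinRaise 1) * onSite x (spinLower 1) : Op Λ 2) σ σ = 1 := by
  rw [onSite_mul, onSite_apply, if_pos fun _ _ => rfl, Matrix.mul_apply, Fin.sum_univ_two, hσx,
    spinRaise_one_zero_zero, zero_mul, zero_add, spinRaise_one_zero_one, spinLower_one_one_zero,
    mul_one]

/-- The weight of the indicator configuration of a finset `S` (`1` = down on `S`) is `|S|`.
[folklore] -/
theorem weight_indicator (S : Finset Λ) :
    (∑ z, (((if z ∈ S then (1 : Fin 2) else 0) : Fin 2) : ℕ)) = S.card := by
  have h : ∀ z : Λ, ((((if z ∈ S then (1 : Fin 2) else 0) : Fin 2) : ℕ)) =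
      if z ∈ S then 1 else 0 := by
    intro z
    split_ifs <;> rfl
  simp only [h]
  rw [Finset.sum_ite_mem, Finset.univ_inter, Finset.sum_const, smul_eq_mul, mul_one]

end Entries

/-- **`stub_transverseKernelPos`** (crux `Block2InfDivXXZ`, line `birth`, stub 1; registered
signature, re-registered `:=`-free 2026-08-17 — `@spinZSector (TorusSite 2 M) _ _ 1 0` is the
skeleton's `spinZSector (Λ := TorusSite 2 M) 1 0`, same term): for every even `M ≥ 4`, every `Δ ∈ [-1,0]` and every normalised `S^z_tot = 0` sector
ground state `ψ` of `xxzHamiltonian 1 (torusGraph 2 M) (-1) Δ`, `0 < Re⟨ψ, S⁺_{x'} S⁻_{y'} ψ⟩` for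
all sites. Perron–Frobenius in the weight sector `W = M²/2` (`xxz_sector_perronFrobenius`,
`sector_groundVec_pos`): `ψ = c • ψ₀`, `c ≠ 0`, `ψ₀` real and strictly positive on the sector;
`S⁺_{x'} S⁻_{y'}` is entrywise nonnegative real with a witness entry `1` inside the sector.
Marshall (1955); Tasaki (2020) §2.4; Kennedy–Lieb–Shastry, PRL 61 (1988) 2582. [folklore] -/
theorem stub_transverseKernelPos :
    ∀ (M : ℕ) [NeZero M], Even M → 4 ≤ M → ∀ Δ ∈ Set.Icc (-1:ℝ) 0,
      ∀ (ψ : TensorIndex (TorusSite 2 M) 2 → ℂ),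
        ψ ∈ @spinZSector (TorusSite 2 M) _ _ 1 0 → star ψ ⬝ᵥ ψ = 1 →
        Matrix.mulVec (xxzHamiltonian 1 (torusGraph 2 M) (-1) Δ) ψ =
          ((lowestEnergyInSector 1 (xxzHamiltonian 1 (torusGraph 2 M) (-1) Δ) 0 : ℝ) : ℂ) • ψ →
        ∀ x' y' : TorusSite 2 M,
          0 < (star ψ ⬝ᵥ Matrix.mulVec
            (onSite x' (spinRaise 1) * onSite y' (spinLower 1)) ψ).re := by
  intro M _ hEven h4 Δ _hΔ ψ hψ hnorm heig x' y'
  obtain ⟨k, hk⟩ := hEven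
  -- the weight of the `S^z_tot = 0` sector
  set W : ℕ := 2 * k * k with hWdef
  have hk2 : 2 ≤ k := by omega
  have hcardU : (Finset.univ : Finset (TorusSite 2 M)).card = M ^ 2 := by
    rw [Finset.card_univ, card_torusSite]
  have hM2 : M ^ 2 = 4 * k * k := by rw [hk]; ring
  have hWle : W ≤ M ^ 2 := by rw [hM2, hWdef]; nlinarith
  have hW1 : 1 ≤ W := by rw [hWdef]; nlinarith
  have hWlt : W + 2 ≤ M ^ 2 := by rw [hM2, hWdef]; nlinarith
  have hsecR : ((Fintype.card (TorusSite 2 M) * 1 : ℕ) : ℝ) / 2 - (W : ℝ) = 0 := by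
    rw [card_torusSite, hWdef, hk]
    push_cast
    ring
  set H := xxzHamiltonian 1 (torusGraph 2 M) (-1) Δ with hHdef
  -- entries of `H`: stoquastic, weight preserving (zero field)
  have hent :=
    Summit.AtomisticToContinuum.BoseEinsteinCondensation.Cruxes.GroundStateStability.StableConeVariationalSelection.leadPF_entries
      (torusGraph 2 M) Δ (fun _ => (0 : ℝ))
  simp only [Complex.ofReal_zero, zero_smul, Finset.sum_const_zero, add_zero] at hent
  obtain ⟨happ, hreal, -, hoff, -⟩ := hent
  have hhop : ∀ σ τ : TensorIndex (TorusSite 2 M) 2, σ ≠ τ →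
      heisenbergHamiltonian 1 (torusGraph 2 M) 1 σ τ ≠ 0 → H σ τ ≠ 0 :=
    fun σ τ hστ h h0 => h (neg_eq_zero.1 ((happ σ τ hστ).symm.trans h0))
  have hWex : ∃ σ : TensorIndex (TorusSite 2 M) 2, (∑ z, (σ z : ℕ)) = W :=
    exists_config_weight_eq 2 M W hWle
  -- the Perron vector of the sector: nonnegative (landed), unique, hence strictly positive
  obtain ⟨⟨ψ₀, hψ₀K, hψ₀0, hψ₀nn, hHψ₀⟩, huniq⟩ :=
    xxz_sector_perronFrobenius (torusGraph 2 M) (torusGraph_connected 2 M) Δ W hWex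
  have hoffK : ∀ σ, (∑ z, (σ z : ℕ)) ≠ W → ψ₀ σ = 0 :=
    (LiebMattis.mem_spinZSector_weight_iff 1 W ψ₀).1 hψ₀K
  have hpos : ∀ σ, (∑ z, (σ z : ℕ)) = W → 0 < (ψ₀ σ).re :=
    sector_groundVec_pos 1 (torusGraph 2 M) (torusGraph_connected 2 M) H hhop hreal hoff W hoffK
      hψ₀nn hHψ₀ hψ₀0
  rw [hsecR] at hψ₀K hHψ₀ huniq
  obtain ⟨c, hc⟩ := huniq ψ₀ ψ hψ₀K hψ hHψ₀ heig hψ₀0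
  have hc0 : c ≠ 0 := by
    rintro rfl
    rw [zero_smul] at hc
    rw [hc, star_zero, zero_dotProduct] at hnorm
    exact zero_ne_one hnorm
  -- reduce to the Perron vector
  set A : Op (TorusSite 2 M) 2 := onSite x' (spinRaise 1) * onSite y' (spinLower 1) with hAdef
  have hcc : star c * c = ((‖c‖ ^ 2 : ℝ) : ℂ) := by
    rw [Complex.star_def, Complex.conj_mul']
    push_cast
    rfl
  have hquad : star ψ ⬝ᵥ A *ᵥ ψ = ((‖c‖ ^ 2 : ℝ) : ℂ) * (star ψ₀ ⬝ᵥ A *ᵥ ψ₀) := by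
    rw [hc, mulVec_smul, star_smul, smul_dotProduct, dotProduct_smul, smul_smul, hcc, smul_eq_mul]
  rw [hquad, Complex.re_ofReal_mul]
  refine mul_pos (by positivity) ?_
  have hA : ∀ σ τ, 0 ≤ (A σ τ).re ∧ (A σ τ).im = 0 := fun σ τ => raiseLower_nnreal x' y' σ τ
  -- the witness pair
  by_cases hxy : x' = y'
  · subst hxy
    -- `σ₀`: indicator of a `W`-subset avoiding `x'`
    obtain ⟨S, hSsub, hScard⟩ := Finset.exists_subset_card_eq
      (s := (Finset.univ : Finset (TorusSite 2 M)).erase x') (n := W)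
      (by rw [Finset.card_erase_of_mem (Finset.mem_univ _), hcardU]; omega)
    have hxS : x' ∉ S := fun h => (Finset.mem_erase.1 (hSsub h)).1 rfl
    set σ₀ : TensorIndex (TorusSite 2 M) 2 := fun z => if z ∈ S then 1 else 0 with hσ₀def
    have hσ₀W : (∑ z, (σ₀ z : ℕ)) = W := by rw [hσ₀def, weight_indicator, hScard]
    have hσ₀x : σ₀ x' = 0 := by simp [hσ₀def, hxS]
    refine lt_of_lt_of_le ?_ (re_quadForm_ge_entry A ψ₀ hA hψ₀nn σ₀ σ₀)
    rw [hAdef, raiseLower_witness_eq x' σ₀ hσ₀x, Complex.one_re, mul_one]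
    exact mul_pos (hpos σ₀ hσ₀W) (hpos σ₀ hσ₀W)
  · -- `σ₀`: indicator of `insert y' T`, `T` a `(W-1)`-subset avoiding `x', y'`
    obtain ⟨T, hTsub, hTcard⟩ := Finset.exists_subset_card_eq
      (s := ((Finset.univ : Finset (TorusSite 2 M)).erase x').erase y') (n := W - 1)
      (by
        rw [Finset.card_erase_of_mem (Finset.mem_erase.2 ⟨Ne.symm hxy, Finset.mem_univ _⟩),
          Finset.card_erase_of_mem (Finset.mem_univ _), hcardU]
        omega)
    have hyT : y' ∉ T := fun h => (Finset.mem_erase.1 (hTsub h)).1 rfl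
    have hxT : x' ∉ T := fun h => (Finset.mem_erase.1 (Finset.mem_erase.1 (hTsub h)).2).1 rfl
    set S := insert y' T with hSdef
    have hxS : x' ∉ S := by
      rw [hSdef, Finset.mem_insert]
      rintro (h | h)
      · exact hxy h
      · exact hxT h
    have hyS : y' ∈ S := Finset.mem_insert_self _ _
    have hScard : S.card = W := by
      rw [hSdef, Finset.card_insert_of_notMem hyT, hTcard]
      omega
    set σ₀ : TensorIndex (TorusSite 2 M) 2 := fun z => if z ∈ S then 1 else 0 with hσ₀def
    have hσ₀W : (∑ z, (σ₀ z : ℕ)) = W := by rw [hσ₀def, weight_indicator, hScard]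
    have hσ₀x : σ₀ x' = 0 := by simp [hσ₀def, hxS]
    have hσ₀y : σ₀ y' = 1 := by simp [hσ₀def, hyS]
    set τ₀ : TensorIndex (TorusSite 2 M) 2 := Function.update (Function.update σ₀ x' 1) y' 0
      with hτ₀def
    -- `τ₀` is the indicator of `insert x' T`, so it has the same weight
    have hτ₀eq : τ₀ = fun z => if z ∈ insert x' T then 1 else 0 := by
      funext z
      rw [hτ₀def]
      by_cases hzy : z = y'
      · subst hzy
        rw [Function.update_self, if_neg]
        rw [Finset.mem_insert]
        rintro (h | h)
        · exact hxy h.symm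
        · exact hyT h
      · rw [Function.update_of_ne hzy]
        by_cases hzx : z = x'
        · subst hzx
          rw [Function.update_self, if_pos (Finset.mem_insert_self _ _)]
        · rw [Function.update_of_ne hzx, hσ₀def]
          simp only [hSdef, Finset.mem_insert, hzy, hzx, false_or]
    have hτ₀W : (∑ z, (τ₀ z : ℕ)) = W := by
      rw [hτ₀eq, weight_indicator, Finset.card_insert_of_notMem hxT, hTcard]
      omega
    refine lt_of_lt_of_le ?_ (re_quadForm_ge_entry A ψ₀ hA hψ₀nn σ₀ τ₀)
    rw [hAdef, hτ₀def, raiseLower_witness_ne hxy σ₀ hσ₀x hσ₀y, Complex.one_re, mul_one]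
    exact mul_pos (hpos σ₀ hσ₀W) (hpos τ₀ (hτ₀def ▸ hτ₀W))

end Summit.HubbardSuperconductivity.HubbardSuperconductivity.Theorems.LevyLogBootstrap

end
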